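import Literature.MathematicalPhysics.QuantumFieldTheory.Balaban1983to89.Node00.Record13DatumKey
import Literature.MathematicalPhysics.QuantumFieldTheory.Balaban1983to89.Node00.Record13Co

/-!
# NODE 00 (YM-PLAN Track A) — THE STAGE-13 DATUM ∕ RECORD KEYS RE-KEYED ON THE bg-FREE CORE PROVISOS `Stage13Params.Provisos₁₃Core` AT PRINT'S BACKGROUND FIELD:
# the datum `datumOfRecord₁₃Co` of def-T's `Node00/Record13Co` (RECORD 13 re-based on the co-divergent-class minimiser, director-ym №152 (β)) — `IsDatumOfRecord₁₃CCo`
# (+ `.params ∕ .provisos`, `canon₁₃Co`, `IsRateKey₁₃Co`), the regime keys `IsDatumOfRecord₁₃CCoOn ∕ IsRecordOfRecord₁₃CCoOn ∕ canon₁₃CoOn`, the CN keys at the guard of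
# record `IsDatumOfRecord₁₃CCoN ∕ IsRecordOfRecord₁₃CCoN`; NO bridge from the ‴ ∕ ⁗ ∕ `SepMixed` keys (not statable — another background), the v1.4 keys bridge INTO it

NODE 00 RECORD MODULE (cell `pub-ymgap`, seat `pub-ymgap-node00-def-RR-2` gen 11 = second reader ∕ key + instance side of the RATE-RECORD HOME, director-ym R141 (A);
dag-lead «datum-KEY twin leaf = RR-2 lineage, one declarer»).  THE `Co` TWIN of this seat's `Node00/Record13DatumKey` (the Stage-13 datum ∕ record keys over
`Stage13Params.Provisos₁₃`, v1.1 of def-T's `Node00/Record13`; «‴»), RE-KEYED on def-T's bg-FREE CORE proviso predicate `Stage13Params.Provisos₁₃Core` (v1.2 §9a: the displayed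
provisos of record WITHOUT the background-field row `bg`; UNCHANGED by the re-base — none of its rows reads the background) AND on def-T's RE-BASED datum `datumOfRecord₁₃Co F N θ
(h : θ.Provisos₁₃Core F N)` of `Node00/Record13Co` (director-ym LINE №152, RULING (β): print's background field of record is the minimiser over [6]'s class (6) = (1.7) ∧ (1.9) —
node00-def-R's `UbgMSCoOfRecord` (`Node00/LargeFieldBackgroundCoOfRecord`), def-T's `UbgOfRecord₁₃Co` — and the §2 form, the 𝐑-leaf, the Stage-5 residual `Stage13Params.toStage5₁₃Co`,
the core, the tower and the datum of RECORD 13 are re-generated AT THAT BACKGROUND, token for token (def-T KEY-RULE-21 R1–R6); v1.2's `towerOfRecord₁₃Core ∕ datumOfRecord₁₃Core`,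
generated at `UbgOfRecord₁₃`, stay in the tree as pre-№152 siblings NOBODY keys on).  WHY THIS KEY (plan g67 CORE-YES, dag-n22-e DESIGN-INPUT-CORE, director-ym №152 §4 «key ONCE,
on Core(Co)»): the ≈ 30 rate-record ∕ spine-record CONSUMER storeys are bg-BLIND and proviso-FIELD-blind — the proviso proof enters ONLY as a binder type and inside the applied
datum — so they key ONCE on `(hc : θ.Provisos₁₃Core F N)` ∕ `datumOfRecord₁₃Co F N θ hc` and are applied at a v1.4 item's tuple `(θ, h : θ.Provisos₁₃SepCo F N)` by `hc :=
h.toCore`, the datum agreeing by `rfl` (def-T's `datumOfRecord₁₃SepCo_eq_co`); a later located revision of the `bg` row over the SAME background then costs the consumer side NO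
file.  The route's ITEM texts (rev 20) key on the proviso OF RECORD `Provisos₁₃SepCo` (the item must SEE the `bg` row); the item-facing junction sentences live in this seat's
`Node00/Record13DatumKeySepCo`, whose §8 bridges the v1.4-keyed classes INTO the classes below.  This module is the token map applied to `Node00/Record13DatumKey`: EVERY
declaration of §1–§7 below is the v1.1-keyed declaration with `(h : θ.Provisos₁₃ F N) ↦ (h : θ.Provisos₁₃Core F N)`, `datumOfRecord₁₃ ↦ datumOfRecord₁₃Co`, `θ.toStage5₁₃ ↦
θ.toStage5₁₃Co`, `IsRecordOfRecord₁₃C… ↦ IsRecordOfRecord₁₃CCo…` in its statement and proof, under the NAME RULE «def-T's token `Co` at def-T's position» (KEY-RULE-21 R1 ∕ R2):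
`IsDatumOfRecord₁₃C ↦ IsDatumOfRecord₁₃CCo`, `IsDatumOfRecord₁₃COn ↦ IsDatumOfRecord₁₃CCoOn`, `IsDatumOfRecord₁₃CN ↦ IsDatumOfRecord₁₃CCoN`, `IsRecordOfRecord₁₃COn ∕ CN ↦
IsRecordOfRecord₁₃CCoOn ∕ CCoN`, `canon₁₃ ↦ canon₁₃Co`, `canon₁₃On ↦ canon₁₃CoOn`, `IsRateKey₁₃ ↦ IsRateKey₁₃Co`, the theorem stems likewise (`isDatumOfRecord₁₃CCo_datumOfRecord₁₃Co`,
`exists_keyed_canon₁₃Co_iff`, `keyed_canon₁₃CoOn_coherent`, `forall_isRecordOfRecord₁₃CCoN_iff`, …) — equivalently, the ⁗ module `Node00/Record13DatumKeySep` with `CSep ↦ CCo`,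
`canon₁₃Sep ↦ canon₁₃Co`, `IsRateKey₁₃Sep ↦ IsRateKey₁₃Co`, `Provisos₁₃Sep ↦ Provisos₁₃Core`, `datumOfRecord₁₃Sep ↦ datumOfRecord₁₃Co`.  KEYED FLAT on `datumOfRecord₁₃Co`.  APPEND-ONLY:
a NEW leaf importing `Node00/Record13DatumKey` (the ‴ key: θ-level assignments and the guard of record, by name) and def-T's `Node00/Record13Co` (hence `Node00/Record13` v1.2 and
`Node00/LargeFieldBackgroundCoOfRecord`); NOTHING landed is edited — the ‴, ⁗ and `SepMixed` key modules stand VERBATIM (keys of the pre-№152 editions).  CONSUMED BY NAME from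
def-T's `Node00/Record13` (v1.2 §9a): `Stage13Params.Provisos₁₃Core`; from def-T's `Node00/Record13Co`: `datumOfRecord₁₃Co`, `Stage13Params.toStage5₁₃Co`, the RECORD PREDICATE
`IsRecordOfRecord₁₃CCo F N D w` := `∃ θ (h : θ.Provisos₁₃Core F N), θ.Admissible F N ∧ D = datumOfRecord₁₃Co F N θ h ∧ w.C = D.C ∧ (0 < w.γ ∧ w.γ ≤ θ.γ) ∧ w.L = θ.L ∧ ∀ P, w.up P =
upOfRecord₅C F N (θ.toStage5₁₃Co F N) P` (clause order identical to `…C ∕ …CSep ∕ …CSepMixed`), `exists_world_isRecordOfRecord₁₃CCo`, `exists_provisos_of_isRecordOfRecord₁₃CCo`,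
`exists_isRecordOfRecord₅C_of_isRecordOfRecord₁₃CCo`, the `rfl` ∕ read-off faces `βfun_ ∕ flow_g_ ∕ av_ ∕ isDatumOfRecord₀_datumOfRecord₁₃Co`, `isPrintedAveraged_datumOfRecord₁₃Co`;
REUSED BY NAME from `Node00/Record13DatumKey` (θ-level, proviso-free, background-free — NOT twinned): the residual-assignment types and lifts `RateAssignment₁₃ ∕ SpineAssignment₁₃`
(`.ofStageFree ∕ .of₁₁ ∕ .of₁₂ ∕ .toStageFree`, `rateAssignment₁₃OfStageFree ∕ Of₁₁ ∕ Of₁₂`, `spineAssignment₁₃OfStageFree ∕ Of₁₁ ∕ Of₁₂`) and the guard of record `unityNondeg₁₃ ∕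
unityNondeg₁₃_iff`; background-free θ-level tokens of record unchanged (`gOfRecord₁₃`, `betaOfRecord₁₃`, `Stage13Params.Admissible ∕ .ZtUnity ∕ .SlotsNondegenerate₁₃`).  The key
layer is PROVISO-FIELD-BLIND and BACKGROUND-BLIND (no declaration here projects a field of `Provisos₁₃Core` or reads `UbgOfRecord₁₃Co`), which is why the re-key is a token map
and every proof term of §1–§7 is the v1.1 proof term.

WHY THIS OBJECT (as at v1.1 ∕ v1.2; said once more for the core reader).  The rate-record home and the spine-record home of clusters K4 ∕ K5 are read JOINTLY by the N19′
edge, so both are keyed to ONE parameter per datum: THE CANONICAL PARAMETER `h.params := Classical.choose h` of `h : IsDatumOfRecord₁₃CCo F N D`, with `h.provisos :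
h.params.Provisos₁₃Core F N`, `h.admissible`, `h.eq_datumOfRecord₁₃Co : D = datumOfRecord₁₃Co F N h.params h.provisos`; every θ-level object of record then has ONE
datum-level instance per `(F, D, g₀, os)`, records keyed «`∃ θ hP, θ.Admissible F N ∧ D = datumOfRecord₁₃Co F N θ hP ∧ S = canon₁₃Co F N cr θ hP g₀ os`» are COHERENT
(`exists_keyed_canon₁₃Co_iff`, `keyed_canon₁₃Co_coherent`), and a consumer proving its node at EVERY admissible tuple with core provisos proves it at the datum
(`IsDatumOfRecord₁₃CCo.forall_params`).  `isDatumOfRecord₁₃CCo_iff_exists_world`: the datum class IS def-T's `IsRecordOfRecord₁₃CCo` with the world forgotten;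
«`∃ D w, IsRecordOfRecord₁₃CCo F N D w`» REDUCES HONESTLY to «one admissible Stage-13 tuple with every field of `Provisos₁₃Core` a theorem»
(`exists_isDatumOfRecord₁₃CCo_iff_exists_params`) — INHABITATION IS NOT CLAIMED HERE.  `IsRateKey₁₃Co F N D w θ` is `IsRecordOfRecord₁₃CCo`'s body with θ EXPOSED
(`isRecordOfRecord₁₃CCo_iff_exists_isRateKey₁₃Co`, `Iff.rfl`).  THE REGIME KEYS (§4–§6): a reading that CONSUMES a regime `Rg : (F : T4Family) → Stage13Params F N → Prop`
quantifies over `IsDatumOfRecord₁₃CCoOn F N Rg D` ∕ `IsRecordOfRecord₁₃CCoOn F N Rg D w` (canonical parameter IN the regime, `h.regime`; junction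
`forall_isRecordOfRecord₁₃CCoOn_iff`; `canon₁₃CoOn Rg` with COHERENCE).  §7 instantiates the CN keys at the guard of record `unityNondeg₁₃ N F θ := θ.ZtUnity F N ∧
θ.SlotsNondegenerate₁₃ F N` with the literal faces `isDatumOfRecord₁₃CCoN_iff`, `exists_isDatumOfRecord₁₃CCoN_iff_exists_params` and `forall_isRecordOfRecord₁₃CCoN_iff`
(= a core-keyed ∀-storey's binder prefix `∀ (θ) (hc : θ.Provisos₁₃Core F N), (θ.ZtUnity F N ∧ θ.SlotsNondegenerate₁₃ F N) → θ.Admissible F N → … (datumOfRecord₁₃Co F N θ hc)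
…`).  At the trivial regime everything is the CCore key again (`isDatumOfRecord₁₃CCoOn_true_iff`, `isRecordOfRecord₁₃CCoOn_true_iff`).  NOMINAL STRENGTH, SAID ONCE: a
core-keyed ∀-storey quantifies over MORE parameters than the item of record (every admissible tuple satisfying the nine bg-free rows, not only those with the background-field
row) — harmless for the θ-generic rate ∕ spine storeys (none reads `bg`), and it is NOT the item's obligation: the item-facing junction stays at the proviso of record.

NO §8 HERE — WHY NO BRIDGE ENTERS THIS KEY FROM THE OLDER KEYS.  `IsDatumOfRecord₁₃C F N D` (‴), `IsDatumOfRecord₁₃CSep F N D` (⁗) and `IsDatumOfRecord₁₃CSepMixed F N D` pin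
`D` to a datum generated at `UbgOfRecord₁₃` (v1.1 ∕ v1.2 ∕ v1.3, or v1.2's `datumOfRecord₁₃Core` by `rfl`); `IsDatumOfRecord₁₃CCo F N D` pins `D` to `datumOfRecord₁₃Co`, generated
at `UbgOfRecord₁₃Co` — two data of record that no `rfl` and no lemma in the tree relate (they would agree only through [15] Thm 1's uniqueness of the minimiser modulo gauge on the
co-divergent class, which is NOT asserted anywhere); so no implication between the older classes and the classes below is statable AT THE SAME DATUM, in either direction,
and none is filed.  The ONLY bridge into this key is from the v1.4-keyed classes (`Node00/Record13DatumKeySepCo` §8: `IsRateKey₁₃SepCo.toCo`, `IsDatumOfRecord₁₃CSepCo[On∕N].toCo`,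
`IsRecordOfRecord₁₃CSepCo(On∕N).toCo` along def-T's `Provisos₁₃SepCo.toCore`, the datum by `rfl`); a Co-keyed ∀-storey is applied at a v1.4 item's tuple `(θ, h)` as `… θ
h.toCore …` — NO converse (`Provisos₁₃Core → Provisos₁₃SepCo` would assert a background-field bound from nothing), and the canonical parameters `h.params ∕ h.toCo.params` of
one datum under the two keys are NOT related by any lemma (two choices).

WHAT IS NOT HERE.  NO edit of any landed key module or consumer; NO bridge from or to the ‴ ∕ ⁗ ∕ `SepMixed` keys (see above); NO `Co → SepCo` bridge; NO `₁₂ ↔ ₁₃` key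
bridge; NO reading of any proviso row or of the background; NO inhabitant of any key; the θ-level assignments and the guard of record are NOT re-declared (imported by name);
def-T's re-based record predicate and its faces are NOT re-declared (consumed by name from `Node00/Record13Co`); NO `Provisos₁₃Core` inhabitant and NO record is claimed to exist.

HONEST FRAMING.  Definitions of record + kernel bookkeeping (`Classical.choose`, `rfl`, `dite`, ∃-repackaging); NOTHING of Bałaban's is asserted; NO inhabitant of any key
is claimed (the record's inhabitation item is OPEN); no node is discharged; counts unmoved (COUNT-NEUTRAL); one finite four-torus programme at fixed `ε` — NOT the
continuum limit on ℝ⁴, NOT infinite volume, NOT OS, NOT a mass gap, NOT the Clay problem.  No `sorry` ∕ `axiom` ∕ `opaque` ∕ `instance` ∕ `notation`.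
[Balaban1989LargeFieldII] = Commun. Math. Phys. **122** (1989) 355–392; [Balaban1988Convergent] = Commun. Math. Phys. **119** (1988) 243–285; [Balaban1988RG2Cluster] =
Commun. Math. Phys. **116** (1988) 1–22; [Balaban1987RG1] = Commun. Math. Phys. **109** (1987) 249–301; [15] = [Balaban1985RegularSpaces] = Commun. Math. Phys. **102** (1985)
277–309, Thm 1 ∕ (1.7)–(1.9) ∕ (6)–(8) pp.278–280 (the regular ∕ co-divergent classes and the minimiser — cited for orientation only, nothing of it asserted).
-/

noncomputable section

namespace Literature.MathematicalPhysics.QuantumFieldTheory.Balaban1983to89.Node00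

open T4Continuum AveragingRT T4FiniteEpsInhabited FlowStep FlowStepRuns DagBinding T4DatumAssembly

/-! ## §1. «`D` is a datum of record, Stage 13» and its CANONICAL parameter -/

section DatumKey

variable (F : T4Family) (N : ℕ) [NeZero N]

/-- **«`D` is a datum of record, Stage 13 (C-class)»**: SOME admissible Stage-13 parameter tuple satisfying its displayed provisos has `D` as its datum of record — the
datum-level shadow of `IsRecordOfRecord₁₃CCo` (the world forgotten; `isDatumOfRecord₁₃CCo_iff_exists_world`). [cite: Balaban1989LargeFieldII, Thm 1 + (0.1) pp.355–356; Balaban1988Convergent, Thms 1–2 pp.262–263 (objects of record; bookkeeping)] -/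
def IsDatumOfRecord₁₃CCo (D : FiniteEpsData F (SU N)) : Prop :=
  ∃ (θ : Stage13Params F N) (h : θ.Provisos₁₃Core F N), θ.Admissible F N ∧ D = datumOfRecord₁₃Co F N θ h

/-- Every admissible Stage-13 parameter tuple with provisos yields a datum of record. [cite: Balaban1989LargeFieldII, Thm 1 + (0.1) pp.355–356 (bookkeeping)] -/
theorem isDatumOfRecord₁₃CCo_datumOfRecord₁₃Co (θ : Stage13Params F N) (h : θ.Provisos₁₃Core F N) (hθ : θ.Admissible F N) :
    IsDatumOfRecord₁₃CCo F N (datumOfRecord₁₃Co F N θ h) :=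
  ⟨θ, h, hθ, rfl⟩

/-- **K0′ READS THE SAME AT THE DATUM**: some datum of record exists at `(F, N)` iff some Stage-13 record pair `(D, w)` exists (the body of the route's K0′
`Record12Inhabited` at `N`). [cite: Balaban1989LargeFieldII, Thm 1 + (0.1) pp.355–356 (bookkeeping)] -/
theorem exists_isDatumOfRecord₁₃CCo_iff_exists_record :
    (∃ D : FiniteEpsData F (SU N), IsDatumOfRecord₁₃CCo F N D) ↔ ∃ (D : FiniteEpsData F (SU N)) (w : WorldP), IsRecordOfRecord₁₃CCo F N D w := by
  constructor
  · rintro ⟨_, θ, hP, hθ, rfl⟩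
    obtain ⟨w, hw, -⟩ := exists_world_isRecordOfRecord₁₃CCo F N θ hP hθ ⟨hθ.toStage9.gamma_pos, le_rfl⟩
    exact ⟨_, w, hw⟩
  · rintro ⟨D, w, hw⟩
    exact ⟨D, exists_provisos_of_isRecordOfRecord₁₃CCo hw⟩

/-- **THE HONEST REDUCTION OF K0′**: some datum of record exists at `(F, N)` iff SOME Stage-13 parameter tuple is admissible and satisfies every displayed proviso —
«exhibit ONE admissible `Stage13Params` with EVERY proviso field a theorem» (the K0′ components); inhabitation is NOT claimed in this module.
[cite: Balaban1988Convergent, (2.7) p.255, (2.21) p.258, (2.28) p.259, (3.16) p.268, (3.21) p.269; Balaban1987RG1, (1.12)–(1.15) p.262 (hypothesis dictionary; bookkeeping)] -/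
theorem exists_isDatumOfRecord₁₃CCo_iff_exists_params :
    (∃ D : FiniteEpsData F (SU N), IsDatumOfRecord₁₃CCo F N D) ↔ ∃ θ : Stage13Params F N, θ.Provisos₁₃Core F N ∧ θ.Admissible F N := by
  constructor
  · rintro ⟨_, θ, hP, hθ, -⟩
    exact ⟨θ, hP, hθ⟩
  · rintro ⟨θ, hP, hθ⟩
    exact ⟨_, isDatumOfRecord₁₃CCo_datumOfRecord₁₃Co F N θ hP hθ⟩

variable {F N}
variable {D : FiniteEpsData F (SU N)} {w : WorldP}

/-- A Stage-13 record's datum is a Stage-13 datum of record. [cite: Balaban1989LargeFieldII, Thm 1 p.355 (bookkeeping)] -/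
theorem isDatumOfRecord₁₃CCo_of_isRecordOfRecord₁₃CCo (h : IsRecordOfRecord₁₃CCo F N D w) : IsDatumOfRecord₁₃CCo F N D :=
  exists_provisos_of_isRecordOfRecord₁₃CCo h

/-- **DATUM OF RECORD ⟺ RECORD AT SOME WORLD.** [cite: Balaban1989LargeFieldII, Thm 1 + (0.1) pp.355–356 (bookkeeping)] -/
theorem isDatumOfRecord₁₃CCo_iff_exists_world : IsDatumOfRecord₁₃CCo F N D ↔ ∃ w : WorldP, IsRecordOfRecord₁₃CCo F N D w := by
  constructor
  · rintro ⟨θ, hP, hθ, rfl⟩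
    obtain ⟨w, hw, -⟩ := exists_world_isRecordOfRecord₁₃CCo F N θ hP hθ ⟨hθ.toStage9.gamma_pos, le_rfl⟩
    exact ⟨w, hw⟩
  · rintro ⟨w, hw⟩
    exact isDatumOfRecord₁₃CCo_of_isRecordOfRecord₁₃CCo hw

/-- **THE CANONICAL STAGE-13 PARAMETER OF A DATUM OF RECORD** (choice) — the ONE key both carrier records of clusters K4 ∕ K5 are read at.
[cite: Balaban1989LargeFieldII, Thm 1 + (0.1) pp.355–356 (bookkeeping)] -/
def IsDatumOfRecord₁₃CCo.params (h : IsDatumOfRecord₁₃CCo F N D) : Stage13Params F N :=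
  Classical.choose h

/-- Its provisos. [cite: Balaban1988Convergent, (2.7) p.255, (2.21) p.258, (2.35) p.261 (bookkeeping)] -/
theorem IsDatumOfRecord₁₃CCo.provisos (h : IsDatumOfRecord₁₃CCo F N D) : h.params.Provisos₁₃Core F N :=
  (Classical.choose_spec h).fst

/-- Its admissibility. [cite: Balaban1987RG1, (1.12) p.262; Balaban1988Convergent, (2.10) p.256 (bookkeeping)] -/
theorem IsDatumOfRecord₁₃CCo.admissible (h : IsDatumOfRecord₁₃CCo F N D) : h.params.Admissible F N :=
  (Classical.choose_spec h).snd.1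

/-- **The datum IS the datum of record of its canonical parameter.** [cite: Balaban1989LargeFieldII, Thm 1 p.355 (bookkeeping)] -/
theorem IsDatumOfRecord₁₃CCo.eq_datumOfRecord₁₃Co (h : IsDatumOfRecord₁₃CCo F N D) : D = datumOfRecord₁₃Co F N h.params h.provisos :=
  (Classical.choose_spec h).snd.2

/-- The canonical parameter's coupling window is positive. [cite: Balaban1987RG1, (0.21) p.256 (bookkeeping)] -/
theorem IsDatumOfRecord₁₃CCo.gamma_pos (h : IsDatumOfRecord₁₃CCo F N D) : 0 < h.params.γ :=
  h.admissible.toStage9.gamma_pos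

/-- … and lies inside `]0, 1[` (the Stage-12 sign `γ < 1` of the tuple's Stage-12 admissibility). [cite: Balaban1988Convergent, (2.28) p.259 (bookkeeping)] -/
theorem IsDatumOfRecord₁₃CCo.gamma_lt_one (h : IsDatumOfRecord₁₃CCo F N D) : h.params.γ < 1 :=
  h.admissible.toStage12.pos₁₂.2.2.2.2

/-- **WHAT A CONSUMER PROVES ⟹ WHAT THE INSTANCE CARRIES**: a property of the objects of record established at EVERY admissible Stage-13 parameter tuple with provisos
holds at the canonical parameter of every datum of record. [cite: Balaban1989LargeFieldII, Thm 1 p.355 (bookkeeping)] -/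
theorem IsDatumOfRecord₁₃CCo.forall_params {P : (D : FiniteEpsData F (SU N)) → (θ : Stage13Params F N) → θ.Provisos₁₃Core F N → Prop}
    (hP : ∀ (θ : Stage13Params F N) (hθ : θ.Provisos₁₃Core F N), θ.Admissible F N → P (datumOfRecord₁₃Co F N θ hθ) θ hθ) (h : IsDatumOfRecord₁₃CCo F N D) :
    P D h.params h.provisos := by
  have := hP h.params h.provisos h.admissible
  rwa [← h.eq_datumOfRecord₁₃Co] at this

/-- **WORLD COMPANION IN `₁₃C` AT ANY WINDOW BELOW THE CANONICAL ONE**: for `0 < γw ≤ h.params.γ` some world makes `(D, w)` a Stage-13 record with `w.γ = γw` — what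
the N17 home-keying binder («`RRec … R → ∃ w, IsRecordOfRecord₁₃CCo F N D w ∧ R.u3.γ = w.γ`») consumes once `R.u3.γ` is pinned in that range.
[cite: Balaban1989LargeFieldII, Thm 1 + (0.1) pp.355–356 (bookkeeping)] -/
theorem IsDatumOfRecord₁₃CCo.exists_world (h : IsDatumOfRecord₁₃CCo F N D) {γw : ℝ} (hγw : 0 < γw ∧ γw ≤ h.params.γ) :
    ∃ w : WorldP, IsRecordOfRecord₁₃CCo F N D w ∧ w.γ = γw := by
  obtain ⟨w, hw, hγ⟩ := exists_world_isRecordOfRecord₁₃CCo F N h.params h.provisos h.admissible hγw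
  exact ⟨w, h.eq_datumOfRecord₁₃Co ▸ hw, hγ⟩

/-- … in particular at the canonical window `h.params.γ` itself. [cite: Balaban1989LargeFieldII, Thm 1 + (0.1) pp.355–356 (bookkeeping)] -/
theorem IsDatumOfRecord₁₃CCo.exists_world_gamma (h : IsDatumOfRecord₁₃CCo F N D) :
    ∃ w : WorldP, IsRecordOfRecord₁₃CCo F N D w ∧ w.γ = h.params.γ :=
  h.exists_world ⟨h.gamma_pos, le_rfl⟩

/-- **THE DATUM's β-FUNCTIONS ARE THE STAGE-13 β OF RECORD AT THE CANONICAL PARAMETER** (def-T's `βfun_datumOfRecord₁₃Co`, `rfl` there; `betaOfRecord₁₃ F N θ` over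
`Stage13Params` is def-T's reducible name for the β of record re-based on the canonical-version transport and the (2.9)-species small-field function — NOT `betaOfRecord₁₀` of Stages 10–12: the histories of record differ, and there is
NO ₁₂ ↔ ₁₃ key bridge in this module) — what the (D4) read-out binders and node N17 read off `D`.
[cite: Balaban1987RG1, (1.20)–(1.22) p.264 (bookkeeping)] -/
theorem IsDatumOfRecord₁₃CCo.βfun_eq_betaOfRecord₁₃ (h : IsDatumOfRecord₁₃CCo F N D) : D.βfun = betaOfRecord₁₃ F N h.params := by
  have := βfun_datumOfRecord₁₃Co F N h.params h.provisos
  rwa [← h.eq_datumOfRecord₁₃Co] at this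

/-- The datum's coupling flow of the run `p` IS the Stage-13 generated history of record of the canonical parameter (def-T's `flow_g_datumOfRecord₁₃Co`).
[cite: Balaban1987RG1, (0.17)–(0.20) pp.255–256 (bookkeeping)] -/
theorem IsDatumOfRecord₁₃CCo.flow_g (h : IsDatumOfRecord₁₃CCo F N D) (p : B12.RunParams) :
    (D.C p).flow.g = gOfRecord₁₃ F N h.params p := by
  have := flow_g_datumOfRecord₁₃Co F N h.params h.provisos p
  rwa [← h.eq_datumOfRecord₁₃Co] at this

/-- The datum's averaging maps ARE the averaging maps of record. [cite: Balaban1987RG1, (0.4) p.253 (bookkeeping)] -/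
theorem IsDatumOfRecord₁₃CCo.av_eq (h : IsDatumOfRecord₁₃CCo F N D) : D.av = avOfRecord F N := by
  have := av_datumOfRecord₁₃Co F N h.params h.provisos
  rwa [← h.eq_datumOfRecord₁₃Co] at this

/-- A Stage-13 datum of record is a datum of record, Stage 0 (binder B1 ∕ node N23's reading). [cite: Balaban1987RG1, (0.3)–(0.4) p.253 (bookkeeping)] -/
theorem IsDatumOfRecord₁₃CCo.isDatumOfRecord₀ (h : IsDatumOfRecord₁₃CCo F N D) : IsDatumOfRecord₀ F N D := by
  rw [h.eq_datumOfRecord₁₃Co]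
  exact isDatumOfRecord₀_datumOfRecord₁₃Co F N h.params h.provisos

/-- N23 · binder B1 at every Stage-13 datum of record. [cite: Balaban1987RG1, (0.4) p.253] -/
theorem IsDatumOfRecord₁₃CCo.isPrintedAveraged (h : IsDatumOfRecord₁₃CCo F N D) : D.IsPrintedAveraged := by
  rw [h.eq_datumOfRecord₁₃Co]
  exact isPrintedAveraged_datumOfRecord₁₃Co F N h.params h.provisos

/-- **THE ₅C SHADOW AT THE CANONICAL PARAMETER**: a Stage-13 datum of record is refined by a Stage-5 C-bound record at some world (def-T's
`exists_isRecordOfRecord₅C_of_isRecordOfRecord₁₃CCo` through the world companion) — for consumers keyed at ₅C. [cite: Balaban1989LargeFieldII, Thm 1 + (0.1) pp.355–356 (bookkeeping)] -/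
theorem IsDatumOfRecord₁₃CCo.exists_isRecordOfRecord₅C (h : IsDatumOfRecord₁₃CCo F N D) :
    ∃ (D₅ : FiniteEpsData F (SU N)) (w : WorldP), IsRecordOfRecord₅C F N D₅ w ∧ D₅.C = D.C ∧ (∀ K g₀ k, D₅.dens K g₀ k = D.dens K g₀ k) ∧
      D₅.βfun = D.βfun ∧ D₅.av = D.av := by
  obtain ⟨w, hw, -⟩ := h.exists_world_gamma
  obtain ⟨D₅, h₅⟩ := exists_isRecordOfRecord₅C_of_isRecordOfRecord₁₃CCo hw
  exact ⟨D₅, w, h₅⟩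

end DatumKey

/-! ## §2. Canonicalised readings — COHERENCE for records keyed «`∃ θ hP, θ.Admissible F N ∧ D = datumOfRecord₁₃Co F N θ hP ∧ S = cr F θ hP …`»

Reading an existentially keyed record through `canon₁₃Co f` makes the admitted bundle a function of the DATUM: `canon₁₃Co f θ hP = f h.params h.provisos` whenever
`datumOfRecord₁₃Co F N θ hP = D` and `h : IsDatumOfRecord₁₃CCo F N D` (`canon₁₃Co_eq_of_eq`), so two records keyed independently but read through `canon₁₃Co` admit, at the
same `(F, D, g₀, os)`, bundles read at the SAME parameter (`exists_keyed_canon₁₃Co_iff` turns either key into «`∃ h : IsDatumOfRecord₁₃CCo F N D, Φ (f h.params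
h.provisos)`»).  Off the datum-of-record class `canon₁₃Co f = f`. -/
section Canon

variable (F : T4Family) (N : ℕ) [NeZero N] {α : Sort*}

/-- **CANONICALISED READING**: read `f` at the canonical parameter of the datum `datumOfRecord₁₃Co F N θ hP` when that datum is of record (admissible), else at
`(θ, hP)` itself.  Kernel bookkeeping (`Classical.dec`, `dite`). [cite: Balaban1989LargeFieldII, Thm 1 + (0.1) pp.355–356 (bookkeeping)] -/
def canon₁₃Co (f : (θ : Stage13Params F N) → θ.Provisos₁₃Core F N → α) (θ : Stage13Params F N) (hP : θ.Provisos₁₃Core F N) : α := by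
  classical
  exact if h : IsDatumOfRecord₁₃CCo F N (datumOfRecord₁₃Co F N θ hP) then f h.params h.provisos else f θ hP

variable {F N}

/-- The canonical parameter depends on the datum only: transport of the key along `D = D'` does not change `.params` (proof irrelevance + `subst`).
[cite: Balaban1989LargeFieldII, Thm 1 + (0.1) pp.355–356 (bookkeeping)] -/
theorem IsDatumOfRecord₁₃CCo.params_congr {D D' : FiniteEpsData F (SU N)} (h : IsDatumOfRecord₁₃CCo F N D) (h' : IsDatumOfRecord₁₃CCo F N D') (e : D = D') :
    h.params = h'.params := by
  subst e
  rfl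

/-- **`canon₁₃Co f θ hP = f h.params h.provisos`** whenever `(θ, hP)` realises a datum of record `D` with key `h`. [cite: Balaban1989LargeFieldII, Thm 1 + (0.1) pp.355–356 (bookkeeping)] -/
theorem canon₁₃Co_eq_of_eq {f : (θ : Stage13Params F N) → θ.Provisos₁₃Core F N → α} {D : FiniteEpsData F (SU N)} (h : IsDatumOfRecord₁₃CCo F N D)
    (θ : Stage13Params F N) (hP : θ.Provisos₁₃Core F N) (e : D = datumOfRecord₁₃Co F N θ hP) :
    canon₁₃Co F N f θ hP = f h.params h.provisos := by
  subst e
  unfold canon₁₃Co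
  rw [dif_pos h]

/-- At the canonical parameter itself `canon₁₃Co f` reads `f`. [cite: Balaban1989LargeFieldII, Thm 1 + (0.1) pp.355–356 (bookkeeping)] -/
theorem canon₁₃Co_params {f : (θ : Stage13Params F N) → θ.Provisos₁₃Core F N → α} {D : FiniteEpsData F (SU N)} (h : IsDatumOfRecord₁₃CCo F N D) :
    canon₁₃Co F N f h.params h.provisos = f h.params h.provisos :=
  canon₁₃Co_eq_of_eq h h.params h.provisos h.eq_datumOfRecord₁₃Co

/-- At an admissible tuple with provisos, `canon₁₃Co f` reads `f` at the canonical parameter of ITS datum. [cite: Balaban1989LargeFieldII, Thm 1 + (0.1) pp.355–356 (bookkeeping)] -/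
theorem canon₁₃Co_eq_of_admissible {f : (θ : Stage13Params F N) → θ.Provisos₁₃Core F N → α} (θ : Stage13Params F N) (hP : θ.Provisos₁₃Core F N) (hθ : θ.Admissible F N) :
    canon₁₃Co F N f θ hP = f (isDatumOfRecord₁₃CCo_datumOfRecord₁₃Co F N θ hP hθ).params (isDatumOfRecord₁₃CCo_datumOfRecord₁₃Co F N θ hP hθ).provisos :=
  canon₁₃Co_eq_of_eq _ θ hP rfl

/-- Off the datum-of-record class nothing is canonicalised. [cite: Balaban1989LargeFieldII, Thm 1 + (0.1) pp.355–356 (bookkeeping)] -/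
theorem canon₁₃Co_eq_self_of_not {f : (θ : Stage13Params F N) → θ.Provisos₁₃Core F N → α} (θ : Stage13Params F N) (hP : θ.Provisos₁₃Core F N)
    (hn : ¬ IsDatumOfRecord₁₃CCo F N (datumOfRecord₁₃Co F N θ hP)) : canon₁₃Co F N f θ hP = f θ hP := by
  unfold canon₁₃Co
  rw [dif_neg hn]

/-- **THE KEYED-RECORD FACE**: an existentially keyed record («some admissible `θ` with provisos realises `D` and the bundle reads `canon₁₃Co f` there») IS the
datum-keyed record («the bundle reads `f` at the canonical parameter of `D`») — for every property `Φ` of the reading (e.g. `Φ x := S = x g₀ os`).  This is the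
sentence that makes (T-SPINE)'s and (T-RATE)'s Stage-13 records COHERENT. [cite: Balaban1989LargeFieldII, Thm 1 + (0.1) pp.355–356 (bookkeeping)] -/
theorem exists_keyed_canon₁₃Co_iff {f : (θ : Stage13Params F N) → θ.Provisos₁₃Core F N → α} {D : FiniteEpsData F (SU N)} (Φ : α → Prop) :
    (∃ (θ : Stage13Params F N) (hP : θ.Provisos₁₃Core F N), θ.Admissible F N ∧ D = datumOfRecord₁₃Co F N θ hP ∧ Φ (canon₁₃Co F N f θ hP)) ↔
      ∃ h : IsDatumOfRecord₁₃CCo F N D, Φ (f h.params h.provisos) := by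
  constructor
  · rintro ⟨θ, hP, hθ, e, hΦ⟩
    have h : IsDatumOfRecord₁₃CCo F N D := ⟨θ, hP, hθ, e⟩
    refine ⟨h, ?_⟩
    rwa [canon₁₃Co_eq_of_eq (f := f) h θ hP e] at hΦ
  · rintro ⟨h, hΦ⟩
    refine ⟨h.params, h.provisos, h.admissible, h.eq_datumOfRecord₁₃Co, ?_⟩
    rwa [canon₁₃Co_params (f := f) h]

/-- **COHERENCE**: two existentially keyed records read through `canon₁₃Co` admit, at the same datum, readings AT THE SAME PARAMETER.
[cite: Balaban1989LargeFieldII, Thm 1 + (0.1) pp.355–356 (bookkeeping)] -/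
theorem keyed_canon₁₃Co_coherent {β : Sort*} {f : (θ : Stage13Params F N) → θ.Provisos₁₃Core F N → α} {g : (θ : Stage13Params F N) → θ.Provisos₁₃Core F N → β}
    {D : FiniteEpsData F (SU N)} (Φ : α → Prop) (Ψ : β → Prop)
    (hΦ : ∃ (θ : Stage13Params F N) (hP : θ.Provisos₁₃Core F N), θ.Admissible F N ∧ D = datumOfRecord₁₃Co F N θ hP ∧ Φ (canon₁₃Co F N f θ hP))
    (hΨ : ∃ (θ : Stage13Params F N) (hP : θ.Provisos₁₃Core F N), θ.Admissible F N ∧ D = datumOfRecord₁₃Co F N θ hP ∧ Ψ (canon₁₃Co F N g θ hP)) :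
    ∃ h : IsDatumOfRecord₁₃CCo F N D, Φ (f h.params h.provisos) ∧ Ψ (g h.params h.provisos) := by
  obtain ⟨h, h₁⟩ := (exists_keyed_canon₁₃Co_iff Φ).1 hΦ
  obtain ⟨h', h₂⟩ := (exists_keyed_canon₁₃Co_iff Ψ).1 hΨ
  exact ⟨h, h₁, h₂⟩

end Canon

/-! ## §3. The θ-exposed Stage-13 record key `IsRateKey₁₃Co` and the residual ASSIGNMENTS of the rate-record home at Stage 13 (`RateAssignment₁₃` ∕ `SpineAssignment₁₃` over
`Stage13Params`, with the one-token lifts `.ofStage12` ∕ `.ofStage9` of the Stage-12 ∕ Stage-9-typed assignments; RR-1's object containers BY NAME) -/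

section Key

variable (F : T4Family) (N : ℕ) [NeZero N]

/-- **«(D, w) is the Stage-13 record WITH PARAMETERS θ»**: the body of `IsRecordOfRecord₁₃CCo F N D w` with the Stage-13 parameter tuple EXPOSED — θ is admissible and
satisfies its displayed provisos, its datum of record IS `D`, and the world `w` is bound to the construction with a window `0 < w.γ ≤ θ.γ`, Bałaban's block size and
the C-binding of record over the Stage-13 view. [cite: Balaban1989LargeFieldII, Thm 1 + (0.1) pp.355–356; Balaban1987RG1, (0.24)–(0.25) p.257 (objects of record; bookkeeping)] -/
def IsRateKey₁₃Co (D : FiniteEpsData F (SU N)) (w : WorldP) (θ : Stage13Params F N) : Prop :=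
  ∃ h : θ.Provisos₁₃Core F N, θ.Admissible F N ∧ D = datumOfRecord₁₃Co F N θ h ∧ w.C = D.C ∧ (0 < w.γ ∧ w.γ ≤ θ.γ) ∧
    w.L = (θ.L : ℝ) ∧ ∀ P : B12.RunParams, w.up P = upOfRecord₅C F N (θ.toStage5₁₃Co F N) P

/-- **A Stage-13 record IS a keyed record for SOME θ, and conversely** (`Iff.rfl`: the key is `IsRecordOfRecord₁₃CCo`'s body). [cite: Balaban1989LargeFieldII, Thm 1 + (0.1) pp.355–356 (bookkeeping)] -/
theorem isRecordOfRecord₁₃CCo_iff_exists_isRateKey₁₃Co (D : FiniteEpsData F (SU N)) (w : WorldP) :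
    IsRecordOfRecord₁₃CCo F N D w ↔ ∃ θ : Stage13Params F N, IsRateKey₁₃Co F N D w θ := Iff.rfl

/-- **Pointed form of the key** at the datum of record. [cite: Balaban1989LargeFieldII, Thm 1 + (0.1) pp.355–356 (bookkeeping)] -/
theorem isRateKey₁₃Co_of_eq (θ : Stage13Params F N) (h : θ.Provisos₁₃Core F N) (hθ : θ.Admissible F N) (w : WorldP)
    (hC : w.C = (datumOfRecord₁₃Co F N θ h).C) (hγ : 0 < w.γ ∧ w.γ ≤ θ.γ) (hL : w.L = (θ.L : ℝ))
    (hup : ∀ P, w.up P = upOfRecord₅C F N (θ.toStage5₁₃Co F N) P) :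
    IsRateKey₁₃Co F N (datumOfRecord₁₃Co F N θ h) w θ :=
  ⟨h, hθ, rfl, hC, hγ, hL, hup⟩

/-- **Every admissible θ satisfying its provisos is keyed at some world with any window `0 < γw ≤ θ.γ`** — inhabitation of the keyed class is Stage 13's exactly.
[cite: Balaban1989LargeFieldII, Thm 1 + (0.1) pp.355–356 (bookkeeping)] -/
theorem exists_world_isRateKey₁₃Co (θ : Stage13Params F N) (h : θ.Provisos₁₃Core F N) (hθ : θ.Admissible F N) {γw : ℝ} (hγw : 0 < γw ∧ γw ≤ θ.γ) :
    ∃ w : WorldP, IsRateKey₁₃Co F N (datumOfRecord₁₃Co F N θ h) w θ ∧ w.γ = γw := by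
  obtain ⟨w₀⟩ := nonempty_worldP
  exact ⟨{ w₀ with
      C := (datumOfRecord₁₃Co F N θ h).C, γ := γw, L := (θ.L : ℝ), one_lt_L := by exact_mod_cast θ.hL.2,
      up := fun P => upOfRecord₅C F N (θ.toStage5₁₃Co F N) P },
    ⟨h, hθ, rfl, rfl, hγw, rfl, fun _ => rfl⟩, rfl⟩

variable {F N}
variable {D : FiniteEpsData F (SU N)} {w : WorldP} {θ : Stage13Params F N}

/-- A keyed record is a Stage-13 record. [cite: Balaban1989LargeFieldII, Thm 1 + (0.1) pp.355–356 (bookkeeping)] -/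
theorem IsRateKey₁₃Co.isRecordOfRecord₁₃CCo (hk : IsRateKey₁₃Co F N D w θ) : IsRecordOfRecord₁₃CCo F N D w := ⟨θ, hk⟩

/-- … hence its datum is a Stage-13 datum of record. [cite: Balaban1989LargeFieldII, Thm 1 p.355 (bookkeeping)] -/
theorem IsRateKey₁₃Co.isDatumOfRecord₁₃CCo (hk : IsRateKey₁₃Co F N D w θ) : IsDatumOfRecord₁₃CCo F N D :=
  isDatumOfRecord₁₃CCo_of_isRecordOfRecord₁₃CCo hk.isRecordOfRecord₁₃CCo

/-- The key CERTIFIES θ's provisos and admissibility and realises `D` as θ's datum of record. [cite: Balaban1989LargeFieldI, (0.3)–(0.4) p.176 (bookkeeping)] -/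
theorem IsRateKey₁₃Co.exists_provisos (hk : IsRateKey₁₃Co F N D w θ) : ∃ h : θ.Provisos₁₃Core F N, θ.Admissible F N ∧ D = datumOfRecord₁₃Co F N θ h := by
  obtain ⟨h, hθ, hD, -⟩ := hk
  exact ⟨h, hθ, hD⟩

/-- The key's θ is admissible. [cite: Balaban1987RG1, (1.20)–(1.21) p.264 (hypothesis dictionary; bookkeeping)] -/
theorem IsRateKey₁₃Co.admissible (hk : IsRateKey₁₃Co F N D w θ) : θ.Admissible F N := by
  obtain ⟨-, hθ, -⟩ := hk
  exact hθ

/-- The world's window is positive. [cite: Balaban1987RG1, Thm 1 p.259 (bookkeeping)] -/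
theorem IsRateKey₁₃Co.gamma_pos (hk : IsRateKey₁₃Co F N D w θ) : 0 < w.γ := by
  obtain ⟨-, -, -, -, hγ, -⟩ := hk
  exact hγ.1

/-- The world's window sits inside θ's coupling window: `w.γ ≤ θ.γ`. [cite: Balaban1987RG1, Thm 1 p.259 (bookkeeping)] -/
theorem IsRateKey₁₃Co.gamma_le (hk : IsRateKey₁₃Co F N D w θ) : w.γ ≤ θ.γ := by
  obtain ⟨-, -, -, -, hγ, -⟩ := hk
  exact hγ.2

/-- The world reads θ's block factor. [cite: Balaban1987RG1, (0.1) p.251 (bookkeeping)] -/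
theorem IsRateKey₁₃Co.L_eq (hk : IsRateKey₁₃Co F N D w θ) : w.L = (θ.L : ℝ) := by
  obtain ⟨-, -, -, -, -, hL, -⟩ := hk
  exact hL

/-- The world is bound to the datum's construction. [cite: Balaban1989LargeFieldII, Thm 1 + (0.1) pp.355–356 (bookkeeping)] -/
theorem IsRateKey₁₃Co.construction_eq (hk : IsRateKey₁₃Co F N D w θ) : w.C = D.C := by
  obtain ⟨-, -, -, hC, -⟩ := hk
  exact hC

/-- The upstream block of the world is the C-binding of record at the Stage-13 view. [cite: Balaban1989LargeFieldII, Thm 1 + (0.1) pp.355–356 (bookkeeping)] -/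
theorem IsRateKey₁₃Co.up_eq (hk : IsRateKey₁₃Co F N D w θ) (P : B12.RunParams) : w.up P = upOfRecord₅C F N (θ.toStage5₁₃Co F N) P := by
  obtain ⟨-, -, -, -, -, -, hup⟩ := hk
  exact hup P

end Key


/-! ## §4. «`D` is a datum of record, Stage 13, realised IN THE REGIME `Rg`» and its canonical parameter in the regime -/

section DatumKeyOn

variable (F : T4Family) (N : ℕ) [NeZero N]

/-- **«`D` is a datum of record, Stage 13, realised in the regime `Rg`»**: SOME admissible Stage-13 parameter tuple IN `Rg` satisfying its displayed provisos has `D` as its datum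
of record — the common key prefix of the regime-restricted carrier homes (the Stage-13 re-keys of `YMDAG.UVSplit.RRec₁₂On 𝔯 Rg` ∕ `SRec₁₂On cr Rg`).  At `Rg := ⊤` it is the C key (`isDatumOfRecord₁₃CCoOn_true_iff`).
[cite: Balaban1989LargeFieldII, Thm 1 + (0.1) pp.355–356; Balaban1988Convergent, Thms 1–2 pp.262–263 (objects of record; bookkeeping)] -/
def IsDatumOfRecord₁₃CCoOn (Rg : (F : T4Family) → Stage13Params F N → Prop) (D : FiniteEpsData F (SU N)) : Prop :=
  ∃ (θ : Stage13Params F N) (h : θ.Provisos₁₃Core F N), Rg F θ ∧ θ.Admissible F N ∧ D = datumOfRecord₁₃Co F N θ h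

variable (Rg : (F : T4Family) → Stage13Params F N → Prop)

/-- Unfolding (`Iff.rfl`). [cite: Balaban1989LargeFieldII, Thm 1 + (0.1) pp.355–356 (bookkeeping)] -/
theorem isDatumOfRecord₁₃CCoOn_iff (D : FiniteEpsData F (SU N)) :
    IsDatumOfRecord₁₃CCoOn F N Rg D ↔ ∃ (θ : Stage13Params F N) (h : θ.Provisos₁₃Core F N), Rg F θ ∧ θ.Admissible F N ∧ D = datumOfRecord₁₃Co F N θ h :=
  Iff.rfl

/-- Every admissible Stage-13 parameter tuple in the regime with provisos yields a datum of record in the regime. [cite: Balaban1989LargeFieldII, Thm 1 + (0.1) pp.355–356 (bookkeeping)] -/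
theorem isDatumOfRecord₁₃CCoOn_datumOfRecord₁₃Co (θ : Stage13Params F N) (h : θ.Provisos₁₃Core F N) (hRg : Rg F θ) (hθ : θ.Admissible F N) :
    IsDatumOfRecord₁₃CCoOn F N Rg (datumOfRecord₁₃Co F N θ h) :=
  ⟨θ, h, hRg, hθ, rfl⟩

/-- **THE HONEST REDUCTION, IN THE REGIME**: some datum of record in `Rg` exists at `(F, N)` iff SOME Stage-13 parameter tuple satisfies every displayed proviso, lies in `Rg` and
is admissible; inhabitation is NOT claimed in this module. [cite: Balaban1988Convergent, (2.7) p.255, (2.21) p.258, (3.16)–(3.22) pp.268–269; Balaban1987RG1, (1.12)–(1.15) p.262 (hypothesis dictionary; bookkeeping)] -/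
theorem exists_isDatumOfRecord₁₃CCoOn_iff_exists_params :
    (∃ D : FiniteEpsData F (SU N), IsDatumOfRecord₁₃CCoOn F N Rg D) ↔ ∃ θ : Stage13Params F N, θ.Provisos₁₃Core F N ∧ Rg F θ ∧ θ.Admissible F N := by
  constructor
  · rintro ⟨_, θ, hP, hRg, hθ, -⟩
    exact ⟨θ, hP, hRg, hθ⟩
  · rintro ⟨θ, hP, hRg, hθ⟩
    exact ⟨_, isDatumOfRecord₁₃CCoOn_datumOfRecord₁₃Co F N Rg θ hP hRg hθ⟩

/-- **A PROPERTY OF EVERY DATUM OF RECORD IN THE REGIME ⟺ THE θ-KEYED SENTENCE GUARDED BY `Rg`** (datum level). [cite: Balaban1989LargeFieldII, Thm 1 + (0.1) pp.355–356 (bookkeeping)] -/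
theorem forall_isDatumOfRecord₁₃CCoOn_iff (P : FiniteEpsData F (SU N) → Prop) :
    (∀ D : FiniteEpsData F (SU N), IsDatumOfRecord₁₃CCoOn F N Rg D → P D) ↔
      ∀ (θ : Stage13Params F N) (h : θ.Provisos₁₃Core F N), Rg F θ → θ.Admissible F N → P (datumOfRecord₁₃Co F N θ h) := by
  constructor
  · intro hall θ h hRg hθ
    exact hall _ (isDatumOfRecord₁₃CCoOn_datumOfRecord₁₃Co F N Rg θ h hRg hθ)
  · rintro hall D ⟨θ, h, hRg, hθ, rfl⟩
    exact hall θ h hRg hθ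

variable {F N Rg}
variable {D : FiniteEpsData F (SU N)}

/-- The regime forgotten: a datum of record in `Rg` is a datum of record (C key). [cite: Balaban1989LargeFieldII, Thm 1 p.355 (bookkeeping)] -/
theorem IsDatumOfRecord₁₃CCoOn.toC (h : IsDatumOfRecord₁₃CCoOn F N Rg D) : IsDatumOfRecord₁₃CCo F N D := by
  obtain ⟨θ, hP, -, hθ, hD⟩ := h
  exact ⟨θ, hP, hθ, hD⟩

/-- Monotone in the regime. [cite: Balaban1989LargeFieldII, Thm 1 p.355 (bookkeeping)] -/
theorem IsDatumOfRecord₁₃CCoOn.mono {Rg' : (F : T4Family) → Stage13Params F N → Prop} (hle : ∀ (F : T4Family) (θ : Stage13Params F N), Rg F θ → Rg' F θ)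
    (h : IsDatumOfRecord₁₃CCoOn F N Rg D) : IsDatumOfRecord₁₃CCoOn F N Rg' D := by
  obtain ⟨θ, hP, hRg, hθ, hD⟩ := h
  exact ⟨θ, hP, hle F θ hRg, hθ, hD⟩

/-- At the trivial regime the key IS the C key. [cite: Balaban1989LargeFieldII, Thm 1 p.355 (bookkeeping)] -/
theorem isDatumOfRecord₁₃CCoOn_true_iff : IsDatumOfRecord₁₃CCoOn F N (fun _ _ => True) D ↔ IsDatumOfRecord₁₃CCo F N D :=
  ⟨fun h => h.toC, fun ⟨θ, hP, hθ, hD⟩ => ⟨θ, hP, trivial, hθ, hD⟩⟩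

/-- A datum of record whose C-CANONICAL parameter lies in the regime is a datum of record in the regime (companion of the (T-RATE) home's `rRec₁₂On_of_regime_params`, re-keyed).
[cite: Balaban1989LargeFieldII, Thm 1 p.355 (bookkeeping)] -/
theorem IsDatumOfRecord₁₃CCo.isDatumOfRecord₁₃CCoOn_of_regime_params (h : IsDatumOfRecord₁₃CCo F N D) (hRg : Rg F h.params) : IsDatumOfRecord₁₃CCoOn F N Rg D :=
  ⟨h.params, h.provisos, hRg, h.admissible, h.eq_datumOfRecord₁₃Co⟩

/-- **THE CANONICAL STAGE-13 PARAMETER OF A DATUM OF RECORD IN THE REGIME** (choice).  HONEST: it need not equal the C-canonical parameter `h.toC.params` of the same datum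
(two choices over two existentials); the regime reaches THIS parameter (`.regime`), never `IsDatumOfRecord₁₃CCo.params`. [cite: Balaban1989LargeFieldII, Thm 1 + (0.1) pp.355–356 (bookkeeping)] -/
def IsDatumOfRecord₁₃CCoOn.params (h : IsDatumOfRecord₁₃CCoOn F N Rg D) : Stage13Params F N :=
  Classical.choose h

/-- Its provisos. [cite: Balaban1988Convergent, (2.7) p.255, (2.21) p.258, (2.35) p.261 (bookkeeping)] -/
theorem IsDatumOfRecord₁₃CCoOn.provisos (h : IsDatumOfRecord₁₃CCoOn F N Rg D) : h.params.Provisos₁₃Core F N :=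
  (Classical.choose_spec h).fst

/-- **It lies IN THE REGIME.** [cite: Balaban1988Convergent, (3.16)–(3.22) pp.268–269 (bookkeeping)] -/
theorem IsDatumOfRecord₁₃CCoOn.regime (h : IsDatumOfRecord₁₃CCoOn F N Rg D) : Rg F h.params :=
  (Classical.choose_spec h).snd.1

/-- Its admissibility. [cite: Balaban1987RG1, (1.12) p.262; Balaban1988Convergent, (2.10) p.256 (bookkeeping)] -/
theorem IsDatumOfRecord₁₃CCoOn.admissible (h : IsDatumOfRecord₁₃CCoOn F N Rg D) : h.params.Admissible F N :=
  (Classical.choose_spec h).snd.2.1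

/-- **The datum IS the datum of record of its canonical parameter in the regime.** [cite: Balaban1989LargeFieldII, Thm 1 p.355 (bookkeeping)] -/
theorem IsDatumOfRecord₁₃CCoOn.eq_datumOfRecord₁₃Co (h : IsDatumOfRecord₁₃CCoOn F N Rg D) : D = datumOfRecord₁₃Co F N h.params h.provisos :=
  (Classical.choose_spec h).snd.2.2

/-- The canonical parameter realises a C-datum key of `D` (pointed form; its `.params` is NOT asserted to be `h.params`). [cite: Balaban1989LargeFieldII, Thm 1 p.355 (bookkeeping)] -/
theorem IsDatumOfRecord₁₃CCoOn.isDatumOfRecord₁₃CCo_params (h : IsDatumOfRecord₁₃CCoOn F N Rg D) :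
    IsDatumOfRecord₁₃CCo F N (datumOfRecord₁₃Co F N h.params h.provisos) :=
  isDatumOfRecord₁₃CCo_datumOfRecord₁₃Co F N h.params h.provisos h.admissible

/-- The canonical parameter's coupling window is positive. [cite: Balaban1987RG1, (0.21) p.256 (bookkeeping)] -/
theorem IsDatumOfRecord₁₃CCoOn.gamma_pos (h : IsDatumOfRecord₁₃CCoOn F N Rg D) : 0 < h.params.γ :=
  h.admissible.toStage9.gamma_pos

/-- … and lies inside `]0, 1[`. [cite: Balaban1988Convergent, (2.28) p.259 (bookkeeping)] -/
theorem IsDatumOfRecord₁₃CCoOn.gamma_lt_one (h : IsDatumOfRecord₁₃CCoOn F N Rg D) : h.params.γ < 1 :=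
  h.admissible.toStage12.pos₁₂.2.2.2.2

/-- The canonical parameter in the regime depends on the datum only. [cite: Balaban1989LargeFieldII, Thm 1 + (0.1) pp.355–356 (bookkeeping)] -/
theorem IsDatumOfRecord₁₃CCoOn.params_congr {D' : FiniteEpsData F (SU N)} (h : IsDatumOfRecord₁₃CCoOn F N Rg D) (h' : IsDatumOfRecord₁₃CCoOn F N Rg D') (e : D = D') :
    h.params = h'.params := by
  subst e
  rfl

/-- **WHAT A CONSUMER PROVES IN THE REGIME ⟹ WHAT THE INSTANCE CARRIES**: a property of the objects of record established at EVERY admissible Stage-13 parameter tuple IN `Rg` with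
provisos holds at the canonical parameter in the regime of every datum of record in the regime — the regime is AVAILABLE as a hypothesis. [cite: Balaban1989LargeFieldII, Thm 1 p.355 (bookkeeping)] -/
theorem IsDatumOfRecord₁₃CCoOn.forall_params {P : (D : FiniteEpsData F (SU N)) → (θ : Stage13Params F N) → θ.Provisos₁₃Core F N → Prop}
    (hP : ∀ (θ : Stage13Params F N) (hθ : θ.Provisos₁₃Core F N), Rg F θ → θ.Admissible F N → P (datumOfRecord₁₃Co F N θ hθ) θ hθ) (h : IsDatumOfRecord₁₃CCoOn F N Rg D) :
    P D h.params h.provisos := by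
  have := hP h.params h.provisos h.regime h.admissible
  rwa [← h.eq_datumOfRecord₁₃Co] at this

/-- The datum's β-functions are the Stage-13 β of record at the canonical parameter. [cite: Balaban1987RG1, (1.20)–(1.22) p.264 (bookkeeping)] -/
theorem IsDatumOfRecord₁₃CCoOn.βfun_eq_betaOfRecord₁₃ (h : IsDatumOfRecord₁₃CCoOn F N Rg D) : D.βfun = betaOfRecord₁₃ F N h.params := by
  have := βfun_datumOfRecord₁₃Co F N h.params h.provisos
  rwa [← h.eq_datumOfRecord₁₃Co] at this

/-- The datum's coupling flow of the run `p` IS the Stage-13 generated history of record of the canonical parameter. [cite: Balaban1987RG1, (0.17)–(0.20) pp.255–256 (bookkeeping)] -/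
theorem IsDatumOfRecord₁₃CCoOn.flow_g (h : IsDatumOfRecord₁₃CCoOn F N Rg D) (p : B12.RunParams) :
    (D.C p).flow.g = gOfRecord₁₃ F N h.params p := by
  have := flow_g_datumOfRecord₁₃Co F N h.params h.provisos p
  rwa [← h.eq_datumOfRecord₁₃Co] at this

/-- A datum of record in the regime is a datum of record, Stage 0. [cite: Balaban1987RG1, (0.3)–(0.4) p.253 (bookkeeping)] -/
theorem IsDatumOfRecord₁₃CCoOn.isDatumOfRecord₀ (h : IsDatumOfRecord₁₃CCoOn F N Rg D) : IsDatumOfRecord₀ F N D :=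
  h.toC.isDatumOfRecord₀


end DatumKeyOn

/-! ## §5. «`(D, w)` is a Stage-13 record realised IN THE REGIME `Rg`»; world companions; the θ-keyed guarded junction -/

section RecordKeyOn

variable (F : T4Family) (N : ℕ) [NeZero N]

/-- **«`(D, w)` is a Stage-13 record (C-class) realised in the regime `Rg`»**: `IsRecordOfRecord₁₃CCo F N D w`'s body (the θ-exposed key `IsRateKey₁₃Co`) with the parameter IN
`Rg` — the regime-restricted record class a guarded composer quantifies over (`Spine`, `S_R00x`, `S_N27x` at `fun F D w => IsRecordOfRecord₁₃CCoOn F N Rg D w`).  At `Rg := ⊤` it is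
`IsRecordOfRecord₁₃CCo` (`isRecordOfRecord₁₃CCoOn_true_iff`). [cite: Balaban1989LargeFieldII, Thm 1 + (0.1) pp.355–356; Balaban1987RG1, (0.24)–(0.25) p.257 (objects of record; bookkeeping)] -/
def IsRecordOfRecord₁₃CCoOn (Rg : (F : T4Family) → Stage13Params F N → Prop) (D : FiniteEpsData F (SU N)) (w : WorldP) : Prop :=
  ∃ θ : Stage13Params F N, Rg F θ ∧ IsRateKey₁₃Co F N D w θ

variable (Rg : (F : T4Family) → Stage13Params F N → Prop)

/-- Unfolding (`Iff.rfl`). [cite: Balaban1989LargeFieldII, Thm 1 + (0.1) pp.355–356 (bookkeeping)] -/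
theorem isRecordOfRecord₁₃CCoOn_iff (D : FiniteEpsData F (SU N)) (w : WorldP) :
    IsRecordOfRecord₁₃CCoOn F N Rg D w ↔ ∃ θ : Stage13Params F N, Rg F θ ∧ IsRateKey₁₃Co F N D w θ :=
  Iff.rfl

/-- **Every admissible θ in the regime with provisos is a record in the regime at some world with any window `0 < γw ≤ θ.γ`.** [cite: Balaban1989LargeFieldII, Thm 1 + (0.1) pp.355–356 (bookkeeping)] -/
theorem exists_world_isRecordOfRecord₁₃CCoOn (θ : Stage13Params F N) (h : θ.Provisos₁₃Core F N) (hRg : Rg F θ) (hθ : θ.Admissible F N) {γw : ℝ}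
    (hγw : 0 < γw ∧ γw ≤ θ.γ) : ∃ w : WorldP, IsRecordOfRecord₁₃CCoOn F N Rg (datumOfRecord₁₃Co F N θ h) w ∧ w.γ = γw := by
  obtain ⟨w, hk, hγ⟩ := exists_world_isRateKey₁₃Co F N θ h hθ hγw
  exact ⟨w, ⟨θ, hRg, hk⟩, hγ⟩

/-- Some datum of record in the regime exists iff some record in the regime exists. [cite: Balaban1989LargeFieldII, Thm 1 + (0.1) pp.355–356 (bookkeeping)] -/
theorem exists_isDatumOfRecord₁₃CCoOn_iff_exists_record :
    (∃ D : FiniteEpsData F (SU N), IsDatumOfRecord₁₃CCoOn F N Rg D) ↔ ∃ (D : FiniteEpsData F (SU N)) (w : WorldP), IsRecordOfRecord₁₃CCoOn F N Rg D w := by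
  constructor
  · rintro ⟨_, θ, hP, hRg, hθ, rfl⟩
    obtain ⟨w, hw, -⟩ := exists_world_isRecordOfRecord₁₃CCoOn F N Rg θ hP hRg hθ ⟨hθ.toStage9.gamma_pos, le_rfl⟩
    exact ⟨_, w, hw⟩
  · rintro ⟨D, w, θ, hRg, hk⟩
    obtain ⟨hP, hθ, hD⟩ := hk.exists_provisos
    exact ⟨D, θ, hP, hRg, hθ, hD⟩

/-- **A WORLD-BLIND PROPERTY AT EVERY RECORD IN THE REGIME ⟺ THE θ-KEYED SENTENCE GUARDED BY `Rg`** — the junction between a composer's conclusion over the regime-restricted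
record class (e.g. `YMDAG.UVSplit.Spine` at `IsRecordOfRecord₁₃CCoOn F N Rg`) and an item text «`∀ θ (h : θ.Provisos₁₃Core F N), Rg F θ → θ.Admissible F N → P (datumOfRecord₁₃Co F N θ h)`».
[cite: Balaban1989LargeFieldII, Thm 1 + (0.1) pp.355–356 (bookkeeping)] -/
theorem forall_isRecordOfRecord₁₃CCoOn_iff (P : FiniteEpsData F (SU N) → Prop) :
    (∀ (D : FiniteEpsData F (SU N)) (w : WorldP), IsRecordOfRecord₁₃CCoOn F N Rg D w → P D) ↔
      ∀ (θ : Stage13Params F N) (h : θ.Provisos₁₃Core F N), Rg F θ → θ.Admissible F N → P (datumOfRecord₁₃Co F N θ h) := by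
  constructor
  · intro hall θ h hRg hθ
    obtain ⟨w, hw, -⟩ := exists_world_isRecordOfRecord₁₃CCoOn F N Rg θ h hRg hθ ⟨hθ.toStage9.gamma_pos, le_rfl⟩
    exact hall _ w hw
  · rintro hall D w ⟨θ, hRg, hk⟩
    obtain ⟨h, hθ, rfl⟩ := hk.exists_provisos
    exact hall θ h hRg hθ

variable {F N Rg}
variable {D : FiniteEpsData F (SU N)} {w : WorldP}

/-- The regime forgotten: a record in the regime is a Stage-13 record. [cite: Balaban1989LargeFieldII, Thm 1 p.355 (bookkeeping)] -/
theorem IsRecordOfRecord₁₃CCoOn.isRecordOfRecord₁₃CCo (h : IsRecordOfRecord₁₃CCoOn F N Rg D w) : IsRecordOfRecord₁₃CCo F N D w := by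
  obtain ⟨θ, -, hk⟩ := h
  exact hk.isRecordOfRecord₁₃CCo

/-- Its datum is a datum of record in the regime. [cite: Balaban1989LargeFieldII, Thm 1 p.355 (bookkeeping)] -/
theorem IsRecordOfRecord₁₃CCoOn.isDatumOfRecord₁₃CCoOn (h : IsRecordOfRecord₁₃CCoOn F N Rg D w) : IsDatumOfRecord₁₃CCoOn F N Rg D := by
  obtain ⟨θ, hRg, hk⟩ := h
  obtain ⟨hP, hθ, hD⟩ := hk.exists_provisos
  exact ⟨θ, hP, hRg, hθ, hD⟩

/-- **THE TUPLE IN THE REGIME BEHIND A RECORD IN THE REGIME** — exactly the hypothesis shape of the (T-RATE) home's `s_R00x_rRec₁₂On_of_regime` (to be re-keyed at ₁₃) («every record of `Rec` comes with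
an admissible tuple with provisos in the regime realising `D`»): ONE application. [cite: Balaban1989LargeFieldII, Thm 1 + (0.1) pp.355–356 (bookkeeping)] -/
theorem IsRecordOfRecord₁₃CCoOn.exists_regime_tuple (h : IsRecordOfRecord₁₃CCoOn F N Rg D w) :
    ∃ (θ : Stage13Params F N) (hP : θ.Provisos₁₃Core F N), Rg F θ ∧ θ.Admissible F N ∧ D = datumOfRecord₁₃Co F N θ hP :=
  h.isDatumOfRecord₁₃CCoOn

/-- Monotone in the regime. [cite: Balaban1989LargeFieldII, Thm 1 p.355 (bookkeeping)] -/
theorem IsRecordOfRecord₁₃CCoOn.mono {Rg' : (F : T4Family) → Stage13Params F N → Prop} (hle : ∀ (F : T4Family) (θ : Stage13Params F N), Rg F θ → Rg' F θ)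
    (h : IsRecordOfRecord₁₃CCoOn F N Rg D w) : IsRecordOfRecord₁₃CCoOn F N Rg' D w := by
  obtain ⟨θ, hRg, hk⟩ := h
  exact ⟨θ, hle F θ hRg, hk⟩

/-- The world's window is positive. [cite: Balaban1987RG1, Thm 1 p.259 (bookkeeping)] -/
theorem IsRecordOfRecord₁₃CCoOn.gamma_pos (h : IsRecordOfRecord₁₃CCoOn F N Rg D w) : 0 < w.γ := by
  obtain ⟨θ, -, hk⟩ := h
  exact hk.gamma_pos

/-- The world is bound to the datum's construction. [cite: Balaban1989LargeFieldII, Thm 1 + (0.1) pp.355–356 (bookkeeping)] -/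
theorem IsRecordOfRecord₁₃CCoOn.construction_eq (h : IsRecordOfRecord₁₃CCoOn F N Rg D w) : w.C = D.C := by
  obtain ⟨θ, -, hk⟩ := h
  exact hk.construction_eq

/-- A Stage-13 record keyed at a θ IN THE REGIME is a record in the regime (pointed intro). [cite: Balaban1989LargeFieldII, Thm 1 + (0.1) pp.355–356 (bookkeeping)] -/
theorem IsRateKey₁₃Co.isRecordOfRecord₁₃CCoOn {θ : Stage13Params F N} (hk : IsRateKey₁₃Co F N D w θ) (hRg : Rg F θ) : IsRecordOfRecord₁₃CCoOn F N Rg D w :=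
  ⟨θ, hRg, hk⟩

/-- At the trivial regime the record key IS `IsRecordOfRecord₁₃CCo`. [cite: Balaban1989LargeFieldII, Thm 1 p.355 (bookkeeping)] -/
theorem isRecordOfRecord₁₃CCoOn_true_iff : IsRecordOfRecord₁₃CCoOn F N (fun _ _ => True) D w ↔ IsRecordOfRecord₁₃CCo F N D w :=
  ⟨fun h => h.isRecordOfRecord₁₃CCo, fun ⟨θ, hk⟩ => ⟨θ, trivial, hk⟩⟩

/-- **DATUM OF RECORD IN THE REGIME ⟺ RECORD IN THE REGIME AT SOME WORLD.** [cite: Balaban1989LargeFieldII, Thm 1 + (0.1) pp.355–356 (bookkeeping)] -/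
theorem isDatumOfRecord₁₃CCoOn_iff_exists_world : IsDatumOfRecord₁₃CCoOn F N Rg D ↔ ∃ w : WorldP, IsRecordOfRecord₁₃CCoOn F N Rg D w := by
  constructor
  · rintro ⟨θ, hP, hRg, hθ, rfl⟩
    obtain ⟨w, hw, -⟩ := exists_world_isRecordOfRecord₁₃CCoOn F N Rg θ hP hRg hθ ⟨hθ.toStage9.gamma_pos, le_rfl⟩
    exact ⟨w, hw⟩
  · rintro ⟨w, hw⟩
    exact hw.isDatumOfRecord₁₃CCoOn

/-- **WORLD COMPANION IN THE REGIME AT ANY WINDOW BELOW THE CANONICAL ONE** (what an N17-type home-keying binder consumes once the U3 radius is pinned in `]0, h.params.γ]`).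
[cite: Balaban1989LargeFieldII, Thm 1 + (0.1) pp.355–356 (bookkeeping)] -/
theorem IsDatumOfRecord₁₃CCoOn.exists_world (h : IsDatumOfRecord₁₃CCoOn F N Rg D) {γw : ℝ} (hγw : 0 < γw ∧ γw ≤ h.params.γ) :
    ∃ w : WorldP, IsRecordOfRecord₁₃CCoOn F N Rg D w ∧ w.γ = γw := by
  obtain ⟨w, hw, hγ⟩ := exists_world_isRecordOfRecord₁₃CCoOn F N Rg h.params h.provisos h.regime h.admissible hγw
  exact ⟨w, h.eq_datumOfRecord₁₃Co ▸ hw, hγ⟩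

/-- … in particular at the canonical window itself. [cite: Balaban1989LargeFieldII, Thm 1 + (0.1) pp.355–356 (bookkeeping)] -/
theorem IsDatumOfRecord₁₃CCoOn.exists_world_gamma (h : IsDatumOfRecord₁₃CCoOn F N Rg D) :
    ∃ w : WorldP, IsRecordOfRecord₁₃CCoOn F N Rg D w ∧ w.γ = h.params.γ :=
  h.exists_world ⟨h.gamma_pos, le_rfl⟩

/-- The ₅C shadow at the canonical parameter in the regime (for consumers keyed at ₅C). [cite: Balaban1989LargeFieldII, Thm 1 + (0.1) pp.355–356 (bookkeeping)] -/
theorem IsDatumOfRecord₁₃CCoOn.exists_isRecordOfRecord₅C (h : IsDatumOfRecord₁₃CCoOn F N Rg D) :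
    ∃ (D₅ : FiniteEpsData F (SU N)) (w : WorldP), IsRecordOfRecord₅C F N D₅ w ∧ D₅.C = D.C ∧ (∀ K g₀ k, D₅.dens K g₀ k = D.dens K g₀ k) ∧
      D₅.βfun = D.βfun ∧ D₅.av = D.av :=
  h.toC.exists_isRecordOfRecord₅C

end RecordKeyOn

/-! ## §6. Canonicalised readings RELATIVE TO THE REGIME — coherence for regime homes keyed «`∃ θ hP, Rg F θ ∧ θ.Admissible F N ∧ D = datumOfRecord₁₃Co F N θ hP ∧ S = cr F θ hP …`»

As `canon₁₃Co` (gen 2) for the C key: reading a regime-keyed record through `canon₁₃CoOn Rg f` makes the admitted bundle a function of the DATUM, read at the canonical parameter IN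
THE REGIME, so two regime homes read through `canon₁₃CoOn Rg` admit, at the same `(F, D, g₀, os)`, bundles read at ONE parameter (`exists_keyed_canon₁₃CoOn_iff`,
`keyed_canon₁₃CoOn_coherent`).  Off the class `canon₁₃CoOn Rg f = f`. -/
section CanonOn

variable (F : T4Family) (N : ℕ) [NeZero N] (Rg : (F : T4Family) → Stage13Params F N → Prop) {α : Sort*}

/-- **CANONICALISED READING RELATIVE TO THE REGIME**: read `f` at the canonical parameter in `Rg` of the datum `datumOfRecord₁₃Co F N θ hP` when that datum is of record in the
regime, else at `(θ, hP)` itself.  Kernel bookkeeping (`Classical.dec`, `dite`). [cite: Balaban1989LargeFieldII, Thm 1 + (0.1) pp.355–356 (bookkeeping)] -/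
def canon₁₃CoOn (f : (θ : Stage13Params F N) → θ.Provisos₁₃Core F N → α) (θ : Stage13Params F N) (hP : θ.Provisos₁₃Core F N) : α := by
  classical
  exact if h : IsDatumOfRecord₁₃CCoOn F N Rg (datumOfRecord₁₃Co F N θ hP) then f h.params h.provisos else f θ hP

variable {F N Rg}

/-- **`canon₁₃CoOn Rg f θ hP = f h.params h.provisos`** whenever `(θ, hP)` realises a datum of record in the regime `D` with key `h`. [cite: Balaban1989LargeFieldII, Thm 1 + (0.1) pp.355–356 (bookkeeping)] -/
theorem canon₁₃CoOn_eq_of_eq {f : (θ : Stage13Params F N) → θ.Provisos₁₃Core F N → α} {D : FiniteEpsData F (SU N)} (h : IsDatumOfRecord₁₃CCoOn F N Rg D)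
    (θ : Stage13Params F N) (hP : θ.Provisos₁₃Core F N) (e : D = datumOfRecord₁₃Co F N θ hP) :
    canon₁₃CoOn F N Rg f θ hP = f h.params h.provisos := by
  subst e
  unfold canon₁₃CoOn
  rw [dif_pos h]

/-- At the canonical parameter in the regime `canon₁₃CoOn Rg f` reads `f`. [cite: Balaban1989LargeFieldII, Thm 1 + (0.1) pp.355–356 (bookkeeping)] -/
theorem canon₁₃CoOn_params {f : (θ : Stage13Params F N) → θ.Provisos₁₃Core F N → α} {D : FiniteEpsData F (SU N)} (h : IsDatumOfRecord₁₃CCoOn F N Rg D) :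
    canon₁₃CoOn F N Rg f h.params h.provisos = f h.params h.provisos :=
  canon₁₃CoOn_eq_of_eq h h.params h.provisos h.eq_datumOfRecord₁₃Co

/-- At an admissible tuple IN THE REGIME with provisos, `canon₁₃CoOn Rg f` reads `f` at the canonical parameter in the regime of ITS datum. [cite: Balaban1989LargeFieldII, Thm 1 + (0.1) pp.355–356 (bookkeeping)] -/
theorem canon₁₃CoOn_eq_of_regime {f : (θ : Stage13Params F N) → θ.Provisos₁₃Core F N → α} (θ : Stage13Params F N) (hP : θ.Provisos₁₃Core F N) (hRg : Rg F θ)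
    (hθ : θ.Admissible F N) :
    canon₁₃CoOn F N Rg f θ hP = f (isDatumOfRecord₁₃CCoOn_datumOfRecord₁₃Co F N Rg θ hP hRg hθ).params (isDatumOfRecord₁₃CCoOn_datumOfRecord₁₃Co F N Rg θ hP hRg hθ).provisos :=
  canon₁₃CoOn_eq_of_eq _ θ hP rfl

/-- Off the class nothing is canonicalised. [cite: Balaban1989LargeFieldII, Thm 1 + (0.1) pp.355–356 (bookkeeping)] -/
theorem canon₁₃CoOn_eq_self_of_not {f : (θ : Stage13Params F N) → θ.Provisos₁₃Core F N → α} (θ : Stage13Params F N) (hP : θ.Provisos₁₃Core F N)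
    (hn : ¬ IsDatumOfRecord₁₃CCoOn F N Rg (datumOfRecord₁₃Co F N θ hP)) : canon₁₃CoOn F N Rg f θ hP = f θ hP := by
  unfold canon₁₃CoOn
  rw [dif_neg hn]

/-- **THE KEYED-RECORD FACE, IN THE REGIME**: a regime-keyed record read through `canon₁₃CoOn Rg f` IS the datum-keyed record «the bundle reads `f` at the canonical parameter in
the regime of `D`», for every property `Φ` of the reading. [cite: Balaban1989LargeFieldII, Thm 1 + (0.1) pp.355–356 (bookkeeping)] -/
theorem exists_keyed_canon₁₃CoOn_iff {f : (θ : Stage13Params F N) → θ.Provisos₁₃Core F N → α} {D : FiniteEpsData F (SU N)} (Φ : α → Prop) :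
    (∃ (θ : Stage13Params F N) (hP : θ.Provisos₁₃Core F N), Rg F θ ∧ θ.Admissible F N ∧ D = datumOfRecord₁₃Co F N θ hP ∧ Φ (canon₁₃CoOn F N Rg f θ hP)) ↔
      ∃ h : IsDatumOfRecord₁₃CCoOn F N Rg D, Φ (f h.params h.provisos) := by
  constructor
  · rintro ⟨θ, hP, hRg, hθ, e, hΦ⟩
    have h : IsDatumOfRecord₁₃CCoOn F N Rg D := ⟨θ, hP, hRg, hθ, e⟩
    refine ⟨h, ?_⟩
    rwa [canon₁₃CoOn_eq_of_eq (f := f) h θ hP e] at hΦ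
  · rintro ⟨h, hΦ⟩
    refine ⟨h.params, h.provisos, h.regime, h.admissible, h.eq_datumOfRecord₁₃Co, ?_⟩
    rwa [canon₁₃CoOn_params (f := f) h]

/-- **COHERENCE IN THE REGIME**: two regime-keyed records read through `canon₁₃CoOn Rg` admit, at the same datum, readings AT THE SAME PARAMETER.
[cite: Balaban1989LargeFieldII, Thm 1 + (0.1) pp.355–356 (bookkeeping)] -/
theorem keyed_canon₁₃CoOn_coherent {β : Sort*} {f : (θ : Stage13Params F N) → θ.Provisos₁₃Core F N → α} {g : (θ : Stage13Params F N) → θ.Provisos₁₃Core F N → β}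
    {D : FiniteEpsData F (SU N)} (Φ : α → Prop) (Ψ : β → Prop)
    (hΦ : ∃ (θ : Stage13Params F N) (hP : θ.Provisos₁₃Core F N), Rg F θ ∧ θ.Admissible F N ∧ D = datumOfRecord₁₃Co F N θ hP ∧ Φ (canon₁₃CoOn F N Rg f θ hP))
    (hΨ : ∃ (θ : Stage13Params F N) (hP : θ.Provisos₁₃Core F N), Rg F θ ∧ θ.Admissible F N ∧ D = datumOfRecord₁₃Co F N θ hP ∧ Ψ (canon₁₃CoOn F N Rg g θ hP)) :
    ∃ h : IsDatumOfRecord₁₃CCoOn F N Rg D, Φ (f h.params h.provisos) ∧ Ψ (g h.params h.provisos) := by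
  obtain ⟨h, h₁⟩ := (exists_keyed_canon₁₃CoOn_iff Φ).1 hΦ
  obtain ⟨h', h₂⟩ := (exists_keyed_canon₁₃CoOn_iff Ψ).1 hΨ
  exact ⟨h, h₁, h₂⟩

end CanonOn

/-! ## §7. THE GUARD OF RECORD «partition of unity ∧ non-degenerate present slots» and the CN instances

The route's Stage-13 items (rev 16, to be minted) bundle `θ.ZtUnity F N` (print's partition of unity for the residual 𝐓-weights, [Balaban1988Convergent] (3.16)–(3.20)) and
`θ.SlotsNondegenerate₁₃ F N` (no present slot of record is the zero density, (3.22)) into ONE conjunction on the datum's own parameter.  Named once as a regime; the «CN key» is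
§4–§6 at that regime. -/

section Guard

variable (F : T4Family) (N : ℕ) [NeZero N]


/-- **THE CN KEY — «`D` is a datum of record, Stage 13, realised by an admissible tuple WITH print's partition of unity AND non-degenerate present slots»**: the datum key
at the guard of record. [cite: Balaban1989LargeFieldII, Thm 1 + (0.1) pp.355–356; Balaban1988Convergent, (3.16)–(3.22) pp.268–269 (objects of record; bookkeeping)] -/
abbrev IsDatumOfRecord₁₃CCoN (D : FiniteEpsData F (SU N)) : Prop :=
  IsDatumOfRecord₁₃CCoOn F N (unityNondeg₁₃ N) D

/-- **THE CN RECORD CLASS** at the guard of record. [cite: Balaban1989LargeFieldII, Thm 1 + (0.1) pp.355–356; Balaban1988Convergent, (3.16)–(3.22) pp.268–269 (objects of record; bookkeeping)] -/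
abbrev IsRecordOfRecord₁₃CCoN (D : FiniteEpsData F (SU N)) (w : WorldP) : Prop :=
  IsRecordOfRecord₁₃CCoOn F N (unityNondeg₁₃ N) D w

/-- **The CN key, literally**: SOME Stage-13 parameter tuple with provisos, `(θ.ZtUnity F N ∧ θ.SlotsNondegenerate₁₃ F N)`, admissible, has `D` as its datum of record (`Iff.rfl`).
[cite: Balaban1989LargeFieldII, Thm 1 + (0.1) pp.355–356; Balaban1988Convergent, (3.16)–(3.22) pp.268–269 (bookkeeping)] -/
theorem isDatumOfRecord₁₃CCoN_iff (D : FiniteEpsData F (SU N)) :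
    IsDatumOfRecord₁₃CCoN F N D ↔
      ∃ (θ : Stage13Params F N) (h : θ.Provisos₁₃Core F N), (θ.ZtUnity F N ∧ θ.SlotsNondegenerate₁₃ F N) ∧ θ.Admissible F N ∧ D = datumOfRecord₁₃Co F N θ h :=
  Iff.rfl

/-- **The CN record class, literally** (`Iff.rfl`). [cite: Balaban1989LargeFieldII, Thm 1 + (0.1) pp.355–356 (bookkeeping)] -/
theorem isRecordOfRecord₁₃CCoN_iff (D : FiniteEpsData F (SU N)) (w : WorldP) :
    IsRecordOfRecord₁₃CCoN F N D w ↔ ∃ θ : Stage13Params F N, (θ.ZtUnity F N ∧ θ.SlotsNondegenerate₁₃ F N) ∧ IsRateKey₁₃Co F N D w θ :=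
  Iff.rfl

/-- Intro at a guarded admissible tuple with provisos. [cite: Balaban1989LargeFieldII, Thm 1 + (0.1) pp.355–356 (bookkeeping)] -/
theorem isDatumOfRecord₁₃CCoN_datumOfRecord₁₃Co (θ : Stage13Params F N) (h : θ.Provisos₁₃Core F N) (hG : θ.ZtUnity F N ∧ θ.SlotsNondegenerate₁₃ F N) (hθ : θ.Admissible F N) :
    IsDatumOfRecord₁₃CCoN F N (datumOfRecord₁₃Co F N θ h) :=
  isDatumOfRecord₁₃CCoOn_datumOfRecord₁₃Co F N _ θ h hG hθ

/-- **K0′ READS THE SAME AT THE CN DATUM**: some CN datum of record exists at `(F, N)` iff SOME Stage-13 parameter tuple satisfies every displayed proviso, print's partition of unity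
and non-degeneracy of the present slots, and is admissible — the body of the route's `Record12Inhabited` (rev 15) at `(F, N)`, verbatim; inhabitation is NOT claimed here.
[cite: Balaban1988Convergent, (2.7) p.255, (2.21) p.258, (2.28) p.259, (3.16)–(3.22) pp.268–269; Balaban1987RG1, (1.12)–(1.15) p.262 (hypothesis dictionary; bookkeeping)] -/
theorem exists_isDatumOfRecord₁₃CCoN_iff_exists_params :
    (∃ D : FiniteEpsData F (SU N), IsDatumOfRecord₁₃CCoN F N D) ↔
      ∃ θ : Stage13Params F N, θ.Provisos₁₃Core F N ∧ (θ.ZtUnity F N ∧ θ.SlotsNondegenerate₁₃ F N) ∧ θ.Admissible F N :=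
  exists_isDatumOfRecord₁₃CCoOn_iff_exists_params F N _

/-- … and iff some CN record exists. [cite: Balaban1989LargeFieldII, Thm 1 + (0.1) pp.355–356 (bookkeeping)] -/
theorem exists_isRecordOfRecord₁₃CCoN_iff_exists_params :
    (∃ (D : FiniteEpsData F (SU N)) (w : WorldP), IsRecordOfRecord₁₃CCoN F N D w) ↔
      ∃ θ : Stage13Params F N, θ.Provisos₁₃Core F N ∧ (θ.ZtUnity F N ∧ θ.SlotsNondegenerate₁₃ F N) ∧ θ.Admissible F N :=
  (exists_isDatumOfRecord₁₃CCoOn_iff_exists_record F N _).symm.trans (exists_isDatumOfRecord₁₃CCoN_iff_exists_params F N)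

/-- **THE K2′ ∕ K3′ JUNCTION**: a world-blind property at EVERY CN record ⟺ the θ-keyed sentence «`∀ θ (h : θ.Provisos₁₃Core F N), (θ.ZtUnity F N ∧ θ.SlotsNondegenerate₁₃ F N) →
θ.Admissible F N → P (datumOfRecord₁₃Co F N θ h)`» — the items' binder prefix (what a `Spine` ∕ endpoint composer over the CN record class reads the text off).
[cite: Balaban1989LargeFieldII, Thm 1 + (0.1) pp.355–356 (bookkeeping)] -/
theorem forall_isRecordOfRecord₁₃CCoN_iff (P : FiniteEpsData F (SU N) → Prop) :
    (∀ (D : FiniteEpsData F (SU N)) (w : WorldP), IsRecordOfRecord₁₃CCoN F N D w → P D) ↔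
      ∀ (θ : Stage13Params F N) (h : θ.Provisos₁₃Core F N), (θ.ZtUnity F N ∧ θ.SlotsNondegenerate₁₃ F N) → θ.Admissible F N → P (datumOfRecord₁₃Co F N θ h) :=
  forall_isRecordOfRecord₁₃CCoOn_iff F N _ P

/-- … datum-level form. [cite: Balaban1989LargeFieldII, Thm 1 + (0.1) pp.355–356 (bookkeeping)] -/
theorem forall_isDatumOfRecord₁₃CCoN_iff (P : FiniteEpsData F (SU N) → Prop) :
    (∀ D : FiniteEpsData F (SU N), IsDatumOfRecord₁₃CCoN F N D → P D) ↔
      ∀ (θ : Stage13Params F N) (h : θ.Provisos₁₃Core F N), (θ.ZtUnity F N ∧ θ.SlotsNondegenerate₁₃ F N) → θ.Admissible F N → P (datumOfRecord₁₃Co F N θ h) :=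
  forall_isDatumOfRecord₁₃CCoOn_iff F N _ P

/-- Every guarded admissible θ with provisos is a CN record at some world with any window `0 < γw ≤ θ.γ`. [cite: Balaban1989LargeFieldII, Thm 1 + (0.1) pp.355–356 (bookkeeping)] -/
theorem exists_world_isRecordOfRecord₁₃CCoN (θ : Stage13Params F N) (h : θ.Provisos₁₃Core F N) (hG : θ.ZtUnity F N ∧ θ.SlotsNondegenerate₁₃ F N) (hθ : θ.Admissible F N)
    {γw : ℝ} (hγw : 0 < γw ∧ γw ≤ θ.γ) : ∃ w : WorldP, IsRecordOfRecord₁₃CCoN F N (datumOfRecord₁₃Co F N θ h) w ∧ w.γ = γw :=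
  exists_world_isRecordOfRecord₁₃CCoOn F N _ θ h hG hθ hγw

variable {F N}
variable {D : FiniteEpsData F (SU N)} {w : WorldP}

/-- **THE GUARD AT THE CANONICAL CN PARAMETER** — the one thing the C key cannot supply. [cite: Balaban1988Convergent, (3.16)–(3.22) pp.268–269 (bookkeeping)] -/
theorem IsDatumOfRecord₁₃CCoN.guard (h : IsDatumOfRecord₁₃CCoN F N D) : h.params.ZtUnity F N ∧ h.params.SlotsNondegenerate₁₃ F N :=
  h.regime

/-- Print's partition of unity at the canonical CN parameter. [cite: Balaban1988Convergent, (3.16)–(3.20) pp.268–269 (bookkeeping)] -/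
theorem IsDatumOfRecord₁₃CCoN.ztUnity (h : IsDatumOfRecord₁₃CCoN F N D) : h.params.ZtUnity F N :=
  h.regime.1

/-- Non-degeneracy of the present slots at the canonical CN parameter. [cite: Balaban1988Convergent, (3.22) p.269 (bookkeeping)] -/
theorem IsDatumOfRecord₁₃CCoN.slotsNondegenerate (h : IsDatumOfRecord₁₃CCoN F N D) : h.params.SlotsNondegenerate₁₃ F N :=
  h.regime.2

/-- **WHAT A CONSUMER PROVES UNDER THE GUARD ⟹ WHAT THE CN INSTANCE CARRIES** (the items' binder order: guard, then admissibility). [cite: Balaban1989LargeFieldII, Thm 1 p.355 (bookkeeping)] -/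
theorem IsDatumOfRecord₁₃CCoN.forall_params {P : (D : FiniteEpsData F (SU N)) → (θ : Stage13Params F N) → θ.Provisos₁₃Core F N → Prop}
    (hP : ∀ (θ : Stage13Params F N) (hθ : θ.Provisos₁₃Core F N), (θ.ZtUnity F N ∧ θ.SlotsNondegenerate₁₃ F N) → θ.Admissible F N → P (datumOfRecord₁₃Co F N θ hθ) θ hθ)
    (h : IsDatumOfRecord₁₃CCoN F N D) : P D h.params h.provisos :=
  IsDatumOfRecord₁₃CCoOn.forall_params hP h

/-- A CN datum is a C datum (the guard forgotten; its C-canonical parameter is NOT asserted to satisfy the guard). [cite: Balaban1989LargeFieldII, Thm 1 p.355 (bookkeeping)] -/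
theorem IsDatumOfRecord₁₃CCoN.isDatumOfRecord₁₃CCo (h : IsDatumOfRecord₁₃CCoN F N D) : IsDatumOfRecord₁₃CCo F N D :=
  h.toC

/-- A CN record is a Stage-13 record. [cite: Balaban1989LargeFieldII, Thm 1 p.355 (bookkeeping)] -/
theorem IsRecordOfRecord₁₃CCoN.isRecordOfRecord₁₃CCo' (h : IsRecordOfRecord₁₃CCoN F N D w) : IsRecordOfRecord₁₃CCo F N D w :=
  h.isRecordOfRecord₁₃CCo

/-- The guarded tuple behind a CN record (feeds the ₁₃ re-key of `s_R00x_rRec₁₂On_of_regime 𝔯 ·` at `unityNondeg₁₃ N` in one application). [cite: Balaban1989LargeFieldII, Thm 1 + (0.1) pp.355–356 (bookkeeping)] -/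
theorem IsRecordOfRecord₁₃CCoN.exists_guarded_tuple (h : IsRecordOfRecord₁₃CCoN F N D w) :
    ∃ (θ : Stage13Params F N) (hP : θ.Provisos₁₃Core F N), (θ.ZtUnity F N ∧ θ.SlotsNondegenerate₁₃ F N) ∧ θ.Admissible F N ∧ D = datumOfRecord₁₃Co F N θ hP :=
  h.exists_regime_tuple

/-- A datum of record whose C-canonical parameter satisfies the guard is a CN datum. [cite: Balaban1989LargeFieldII, Thm 1 p.355 (bookkeeping)] -/
theorem IsDatumOfRecord₁₃CCo.isDatumOfRecord₁₃CCoN_of_guard (h : IsDatumOfRecord₁₃CCo F N D) (hG : h.params.ZtUnity F N ∧ h.params.SlotsNondegenerate₁₃ F N) :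
    IsDatumOfRecord₁₃CCoN F N D :=
  h.isDatumOfRecord₁₃CCoOn_of_regime_params hG

end Guard

end Literature.MathematicalPhysics.QuantumFieldTheory.Balaban1983to89.Node00

end
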